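import Mathlib
import Summits.NavierStokesRegularity.NavierStokesRegularity.Theorems.TaoLadderRungTwoBreakCircuitTableT4
import HarnessLib

/-!
# The table R10#16 («R16», theory-2 g17's clean K41-locking table) as a member of `InTableClass 9` for
# `0 ≤ ε₀ ≤ 0.21` (cell harvest/h2-tao-ladder, seat p2; support for K1(1) = `NoSurvivingDSSOne`, stmt-NavierStokesRegularity-20205)

MODEL lattice tables only; nothing about the Navier–Stokes equations; no item closed.

R16 = (q, e, E, Λ, K) = (0.813267, 0.47789, 1.0, 0.235443, 0.450279) (theory-2 g17 census, table R10#16; p2 g7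
report §28: coherent, STABLE, K41-locked one-shift DSS front down to ε₀ = 0.0025 in forward marching, one-shift
fixed points at ε₀ = 0.02 / 0.015 / 0.01 to ≤ 1e-12). In the tree's normalisation
`circuitTable 0.813267 0.47789 1.0 0.235443 (bigLam ε₀ * 0.450279)` it is symmetric, cancelling and `9`-comparable
for `0 ≤ ε₀ ≤ 21/100` (binding: `9⁻¹ ≤ 0.235443/2`; `0.450279·1.1⁵ ≤ 1`).
-/

noncomputable section

-- `Summit.NavierStokesRegularity.NavierStokesRegularity.…` is the tree's (summit = problem) namespace; the
-- duplicated component is intended, so the dupNamespace linter is silenced for this file.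
set_option linter.dupNamespace false

namespace Summit.NavierStokesRegularity.NavierStokesRegularity.Theorems

open Literature.Analysis.FluidPDE Literature.Analysis.FluidPDE.TaoCascade

/-- **R16 ∈ E₂(9) for `0 ≤ ε₀ ≤ 0.21`.** [cite: Tao2016AveragedNS, §4 (4.2)–(4.3), §6.1; cell vocabulary (`InTableClass`), harvest/h2-tao-ladder theory-2 g17 census (table R10#16) / p2 g7 report §28] -/
theorem inTableClass_circuitTable_R16 {ε₀ : ℝ} (hε0 : 0 ≤ ε₀) (hε : ε₀ ≤ 21 / 100) :
    InTableClass 9 (circuitTable 0.813267 0.47789 1.0 0.235443 (bigLam ε₀ * 0.450279)) := by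
  have hL1 := one_le_bigLam hε0
  have hL2 := bigLam_le_of_le_21 hε0 hε
  refine inTableClass_circuitTable (by norm_num) (by norm_num) (by norm_num) (by norm_num) (by norm_num)
    (by norm_num) (by norm_num) (by norm_num) (by positivity) ?_ (by norm_num) (by norm_num) (by norm_num)
    (by norm_num) ?_
  · nlinarith
  · have : (9 : ℝ)⁻¹ ≤ 1 * 0.450279 / 2 := by norm_num
    nlinarith

end Summit.NavierStokesRegularity.NavierStokesRegularity.Theorems
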